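import Summits.Ventures.CertifiedManyBodySolver.Rows.SourcedTorusRows
import Literature.MathematicalPhysics.QuantumLattice.StoquasticDiamagneticInequality
import HarnessLib

/-!
# BCS-crutch ODLRO floor from two pinning-field energy cells (card `bcs-crutch-odlro-floor`, P1-GC / D1)

HONEST FRAMING: first certified bounds; not a superconductivity verdict; every number certified or
labelled float. WHAT THIS IS NOT: a statement about the Hubbard model — `H_g` below is the BCS-CRUTCH
Hamiltonian `K_L − μN − (g/L²) Δ_d†Δ_d` (an attractive, infinite-range, mean-field `d`-wave pair term added
to the `t–t'` Hubbard torus); at `g = 0` NOTHING is claimed (`g → 0⁺` would be the summit and is not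
touched); the density of a ground state of `H_g` is NOT pinned to the rows' nominal filling (grand
canonical at one `μ`). The floor is a THERMOMETER / typed corollary column beside the pinning-field chord
rows (how much BCS crutch `g` a certified response chord buys pair ODLRO for), never a B1 entry.

Card `bcs-crutch-odlro-floor` (cell hubbard-cq, lens seat hubbard-pc-lens-finite-1, ledger idea
38f85a030e60; critic-2 binding verdict «SURVIVES as instrument-reading / typed corollary, new-combination,
low edge», critic-1 second reading CONCUR). CLASS (verdict condition (2) as narrowed by critic-1): **Fock
space at ONE chemical potential `μ` on ONE finite torus of side `L`** — exactly the class of the energy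
cells `SourcedTorusEnergyLowerRow / UpperRow` of `Rows/SourcedTorusRows.lean` (`Matrix.groundEnergy` of
`dWaveSourceTorusTT' L tp U μ h` on the full Fock space); the thermodynamic-limit density-class variant is
NOT typed (long-range `H_g`: ensemble equivalence is not automatic), so the canonical chords of record
(CERTIFIED-OBS `OBS.PhiDresp.lo.g*.tp0.TLchord473xU2`) are NOT in this file's class.

Contents: D1 `crutchTorusTT'` with `pairSq = Δ_d†Δ_d` (`Δ_d = pairField dWaveFormFactor L`) and the
summit's per-torus functional `pairLRO L ψ = Re⟨ψ, Δ_d†Δ_d ψ⟩/L⁴` (`pairLRO_eq_expect` ↔ the quantity of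
`hasPairFieldLRO_iff_liminf`); the operator square `CrutchLeSourcedAdd` PROVED for `0 < g`
(`crutchLeSourcedAdd_of_pos`); **P1-GC** `CrutchODLROFloorGC` PROVED (`crutchODLROFloorGC_holds`): floor
cell `lo·L² ≤ E₀(K_L − μN)` at `h = 0` and cap cell `E₀(A_L(h₀)) ≤ hi·L²` ⇒ for every `g > 0` and every unit
ground-state vector `ψ` of `H_g`, `(lo − hi − h₀²/g)/g ≤ pairLRO L ψ`; its uniform-in-`L` form
(`crutchODLROFloorGCUniform_holds`) and the by-name reader on two uniform cells with their own `(q, L₀)`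
(`crutchODLROFloor_of_rows`, `pairLRO_pos_of_rows`); and the corollary-column arithmetic — positive iff
`g > g₀ = h₀²/(lo − hi)` (`crutchFloor_pos_iff`), never above the squared chord slope `((lo − hi)/(2h₀))²`
(`crutchFloor_le_chordSlope_sq`, attained at `g = 2g₀`, `crutchFloor_two_g0`): the crutch converts a
certified RESPONSE chord into an ODLRO floor of at most the chord's square and carries no bit beyond the
chord (the card's «does not give» column; critic-2 / transplant-1 BN-T1).

Mechanism: (1) the square `(g/L²)(Δ_d − hL²/g)†(Δ_d − hL²/g) ⪰ 0` gives `E₀(H_g) ≤ E₀(A(h₀)) + h₀²L²/g`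
(a ground vector of `A(h₀)` as trial vector for `H_g`); (2) a unit ground vector `ψ` of `H_g` as trial vector
for `A(0) = K_L − μN` gives `E₀(A(0)) ≤ ⟨ψ, A(0)ψ⟩ = E₀(H_g) + (g/L²)⟨ψ, Δ_d†Δ_d ψ⟩`; (3) the two cells
close the chain — variational principle (`groundEnergy_mul_le_re_quadForm`,
`Matrix.groundEnergy_le_rayleigh_holds`) and `dotProduct_star_self_nonneg`, nothing else.

Corollary-column example (docstring only; no number enters a theorem statement): a zero-field GC floor
cell `∃ L₀, SourcedEnergyLowerRow 0 8 μ 0 1 L₀ ℓ_μ` (e.g. the CANDIDATE job-D nodes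
`Certificates.cert_pin1_jobD_G_{3o2,7o4,2}_…_j257673`) and a cap cell `SourcedEnergyUpperRow 0 8 μ (√2·g) 12
L₀' u` (tiled cluster states) give, by `crutchODLROFloor_of_rows`, `(ℓ_μ − u − 2g²/g')/g' ≤ pairLRO L ψ`
on every torus `12 ∣ L ≥ max L₀ L₀'`, positive for `g' > 2g²/(ℓ_μ − u)`. NOTHING IS ASSERTED about any
model constant: every bound-valued statement is a `def … : Prop` or takes the cells as hypotheses; cells
are instantiated only under `Certificates/`. No `sorry`, no named fact. Seat-side sketch of record:
`pub/hubbard-cq/lean/finite1-CrutchFloorTT.lean` (hubbard-pc-lens-finite-1 g4, sha16 40c1c2a7124effd8).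

References: J. Bardeen, L. N. Cooper, J. R. Schrieffer, Phys. Rev. 108 (1957) 1175, §II (reduced BCS
Hamiltonian); C. N. Yang, Rev. Mod. Phys. 34 (1962) 694, §4 (ODLRO functional); H. Tasaki, *Physics and
Mathematics of Quantum Many-Body Systems* (2020), §2.1 eq. (2.1.6) (variational principle); T. Koma,
H. Tasaki, J. Stat. Phys. 76 (1994) 745, §1 (symmetry-breaking fields and order).
-/

noncomputable section

namespace Summit.Ventures.CertifiedManyBodySolver.Observables

open Literature.MathematicalPhysics.QuantumLattice Summit.Ventures.CertifiedManyBodySolver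
open Matrix HubbardWave0 Literature.Probability.LatticeModels Finset
open scoped BigOperators ComplexOrder

/-- Same local instance as `Rows/SourcedTorusRows.lean` (and the tree's torus soundness files), so that
`dWaveSourceTorusTT' L tp U μ h` elaborates here LITERALLY as inside the row cells; a consumer under another
`DecidableEq (FermionTorus 2 L)` instance bridges with `convert … using _` (`Subsingleton.elim`). -/
local instance (priority := high) instDecidableEqFermionTorusCrutch {L : ℕ} :
    DecidableEq (FermionTorus 2 L) :=
  LinearOrder.toDecidableEq

variable {L : ℕ} [NeZero L]

/-! ## §0  The crutch Hamiltonian and the per-torus ODLRO functional (D1) -/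

section Defs

variable (L) in
/-- `Δ_d† Δ_d` on the torus of side `L`, `Δ_d = pairField dWaveFormFactor L` (the summit's pair field). -/
def pairSq : Matrix (Finset (Orb (FermionTorus 2 L))) (Finset (Orb (FermionTorus 2 L))) ℂ :=
  (pairField dWaveFormFactor L)ᴴ * pairField dWaveFormFactor L

variable (L) in
/-- **D1.** The BCS-crutch Hamiltonian on the torus of side `L`, grand canonical, `t–t'`:
`H_{g,L} = H^{tt'}_L(1,tp,U) − μN − (g/L²) Δ_d†Δ_d = dWaveSourceTorusTT' L tp U μ 0 − (g/L²) • pairSq L`.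
NOT the Hubbard model unless `g = 0`, where nothing below says anything. -/
def crutchTorusTT' (tp U μ g : ℝ) :
    Matrix (Finset (Orb (FermionTorus 2 L))) (Finset (Orb (FermionTorus 2 L))) ℂ :=
  dWaveSourceTorusTT' L tp U μ 0 - ((g / (L : ℝ) ^ 2 : ℝ) : ℂ) • pairSq L

variable (L) in
/-- The summit's functional on one torus: `u_L(ψ) = Re⟨ψ, Δ_d†Δ_d ψ⟩ / L⁴` (pair ODLRO density; its
`liminf` along unit sector vectors is `hasPairFieldLRO_iff_liminf`'s quantity). -/
def pairLRO (ψ : Fock (Orb (FermionTorus 2 L))) : ℝ :=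
  (star ψ ⬝ᵥ pairSq L *ᵥ ψ).re / (L : ℝ) ^ 4

/-- Dictionary: `pairLRO L ψ = Re (expect (Δ_d† Δ_d) ψ) / L⁴` in the tree's `expect` vocabulary
(`Literature.MathematicalPhysics.QuantumLattice.expect`, `hasPairFieldLRO_iff_liminf`). -/
theorem pairLRO_eq_expect (ψ : Fock (Orb (FermionTorus 2 L))) :
    pairLRO L ψ =
      (expect ((pairField dWaveFormFactor L)ᴴ * pairField dWaveFormFactor L) ψ).re / (L : ℝ) ^ 4 :=
  rfl

/-- `0 ≤ pairLRO L ψ` (the functional of a positive operator). -/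
theorem pairLRO_nonneg (ψ : Fock (Orb (FermionTorus 2 L))) : 0 ≤ pairLRO L ψ := by
  unfold pairLRO pairSq
  have h := (posSemidef_conjTranspose_mul_self (pairField dWaveFormFactor L)).dotProduct_mulVec_nonneg ψ
  obtain ⟨hre, -⟩ := Complex.nonneg_iff.mp h
  exact div_nonneg (by simpa using hre) (by positivity)

/-- `H_g` is Hermitian (a real multiple of the positive `Δ_d†Δ_d` subtracted from a Hermitian matrix). -/
theorem crutchTorusTT'_isHermitian (tp U μ g : ℝ) : (crutchTorusTT' L tp U μ g).IsHermitian := by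
  unfold crutchTorusTT' pairSq
  refine (dWaveSourceTorusTT'_isHermitian L tp U μ 0).sub
    (IsHermitian.smul (isHermitian_conjTranspose_mul_self _) ?_)
  rw [isSelfAdjoint_iff, Complex.star_def, Complex.conj_ofReal]

end Defs

/-! ## §1  The cells-to-floor statements (Props) -/

section Props

variable (L) in
/-- **Step (1), operator form** (the card's first lemma; the complete square
`(g/L²)(Δ_d − c L²)†(Δ_d − c L²) ⪰ 0` with `h = g c`, evaluated in a vector `x`):
`Re⟨x, H_g x⟩ ≤ Re⟨x, A(h) x⟩ + (h² L² / g) ‖x‖²`. -/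
def CrutchLeSourcedAdd (tp U μ g h : ℝ) : Prop :=
  ∀ x : Fock (Orb (FermionTorus 2 L)),
    (star x ⬝ᵥ crutchTorusTT' L tp U μ g *ᵥ x).re ≤
      (star x ⬝ᵥ dWaveSourceTorusTT' L tp U μ h *ᵥ x).re +
        h ^ 2 * (L : ℝ) ^ 2 / g * (star x ⬝ᵥ x).re

variable (L) in
/-- **P1-GC** (class = Fock space at one `μ`, one torus). From the two cells — zero-field floor
`lo·L² ≤ E₀(K_L − μN)` and sourced ceiling `E₀(A_L(h₀)) ≤ hi·L²` — every unit ground-state vector of the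
crutch Hamiltonian at every `g > 0` has `(lo − hi − h₀²/g)/g ≤ u_L(ψ)`; positive iff `g > g₀ = h₀²/(lo − hi)`
(`crutchFloor_pos_iff`). -/
def CrutchODLROFloorGC (tp U μ h0 : ℝ) (lo hi : ℚ) : Prop :=
  SourcedTorusEnergyLowerRow L tp U μ 0 lo → SourcedTorusEnergyUpperRow L tp U μ h0 hi →
    ∀ g : ℝ, 0 < g → ∀ ψ : Fock (Orb (FermionTorus 2 L)), star ψ ⬝ᵥ ψ = 1 →
      ψ ∈ (crutchTorusTT' L tp U μ g).groundSpace →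
        (((lo : ℚ) : ℝ) - ((hi : ℚ) : ℝ) - h0 ^ 2 / g) / g ≤ pairLRO L ψ

/-- Uniform-in-`L` form of P1-GC over the uniform cells (`∀ L ≥ L₀`, `q ∣ L`). -/
def CrutchODLROFloorGCUniform (tp U μ h0 : ℝ) (q L₀ : ℕ) (lo hi : ℚ) : Prop :=
  SourcedEnergyLowerRow tp U μ 0 q L₀ lo → SourcedEnergyUpperRow tp U μ h0 q L₀ hi →
    ∀ (L : ℕ) [NeZero L], L₀ ≤ L → q ∣ L →
      ∀ g : ℝ, 0 < g → ∀ ψ : Fock (Orb (FermionTorus 2 L)), star ψ ⬝ᵥ ψ = 1 →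
        ψ ∈ (crutchTorusTT' L tp U μ g).groundSpace →
          (((lo : ℚ) : ℝ) - ((hi : ℚ) : ℝ) - h0 ^ 2 / g) / g ≤ pairLRO L ψ

end Props

/-! ## §2  Corollary-column arithmetic (pure `ℝ`; the «does not give» column as theorems) -/

section Arithmetic

/-- Threshold: for a positive chord `G = lo − hi > 0` and `g > 0`, the floor `(G − h₀²/g)/g` is positive iff
`g > g₀ = h₀²/G`. -/
theorem crutchFloor_pos_iff {G g h0 : ℝ} (hG : 0 < G) (hg : 0 < g) :
    0 < (G - h0 ^ 2 / g) / g ↔ h0 ^ 2 / G < g := by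
  rw [div_pos_iff_of_pos_right hg, sub_pos, div_lt_iff₀ hg, div_lt_iff₀ hG, mul_comm]

/-- «Does not give» column: for every `g > 0` the floor never exceeds the SQUARED CHORD SLOPE
`((lo − hi)/(2h₀))²` — the crutch converts a certified response chord into an ODLRO floor of at most the
chord's square and carries no bit beyond the chord (AM–GM: `G/g − h₀²/g² ≤ G²/(4h₀²)`). -/
theorem crutchFloor_le_chordSlope_sq {G g h0 : ℝ} (hg : 0 < g) (hh : h0 ≠ 0) :
    (G - h0 ^ 2 / g) / g ≤ (G / (2 * h0)) ^ 2 := by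
  have hh2 : 0 < h0 ^ 2 := by positivity
  rw [div_le_iff₀ hg]
  have key : 0 ≤ (G * g - 2 * h0 ^ 2) ^ 2 / (4 * h0 ^ 2 * g) := by positivity
  have expand : (G / (2 * h0)) ^ 2 * g - (G - h0 ^ 2 / g) =
      (G * g - 2 * h0 ^ 2) ^ 2 / (4 * h0 ^ 2 * g) := by
    field_simp
    ring
  linarith

/-- The optimum is attained at `g = 2g₀ = 2h₀²/G`: there the floor equals `((lo − hi)/(2h₀))²`. -/
theorem crutchFloor_two_g0 {G g h0 : ℝ} (hG : G ≠ 0) (hh : h0 ≠ 0) (hg : g = 2 * h0 ^ 2 / G) :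
    (G - h0 ^ 2 / g) / g = (G / (2 * h0)) ^ 2 := by
  subst hg
  field_simp
  ring

end Arithmetic

/-! ## §3  Reduction of P1-GC to the operator square (variational principle + the two cells) -/

section Reduction

/-- In a ground-state vector the quadratic form is `E₀ · ‖v‖²`. -/
theorem re_rayleigh_of_mem_groundSpace {n : Type*} [Fintype n] [DecidableEq n] {A : Matrix n n ℂ}
    {v : n → ℂ} (hv : v ∈ A.groundSpace) :
    (star v ⬝ᵥ A *ᵥ v).re = A.groundEnergy * (star v ⬝ᵥ v).re := by
  rw [(mem_groundSpace_iff A v).1 hv, dotProduct_smul, smul_eq_mul, Complex.mul_re,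
    Complex.ofReal_re, Complex.ofReal_im, zero_mul, sub_zero]

/-- **Step A.** `E₀(H_g) ≤ E₀(A(h)) + h² L²/g` — a ground-state vector of the sourced Hamiltonian is a
trial vector for the crutch Hamiltonian (homogeneous variational principle
`groundEnergy_mul_le_re_quadForm`, no normalisation needed), and the operator square bounds its energy. -/
theorem groundEnergy_crutch_le {tp U μ g h : ℝ} (hop : CrutchLeSourcedAdd L tp U μ g h) :
    (crutchTorusTT' L tp U μ g).groundEnergy ≤
      (dWaveSourceTorusTT' L tp U μ h).groundEnergy + h ^ 2 * (L : ℝ) ^ 2 / g := by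
  have hA : (dWaveSourceTorusTT' L tp U μ h).IsHermitian := dWaveSourceTorusTT'_isHermitian L tp U μ h
  obtain ⟨v, hv, hv0⟩ := (Submodule.ne_bot_iff _).1 (groundSpace_ne_bot_holds hA)
  have hvv : 0 < (star v ⬝ᵥ v).re :=
    (Complex.pos_iff.mp (dotProduct_star_self_pos_iff.mpr hv0)).1
  have h1 := groundEnergy_mul_le_re_quadForm (crutchTorusTT'_isHermitian (L := L) tp U μ g) v
  have h2 := hop v
  rw [re_rayleigh_of_mem_groundSpace hv] at h2
  have h3 : (crutchTorusTT' L tp U μ g).groundEnergy * (star v ⬝ᵥ v).re ≤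
      ((dWaveSourceTorusTT' L tp U μ h).groundEnergy + h ^ 2 * (L : ℝ) ^ 2 / g) *
        (star v ⬝ᵥ v).re := by
    nlinarith
  exact le_of_mul_le_mul_right h3 hvv

/-- **Step B.** For a unit ground-state vector `ψ` of `H_g`:
`Re⟨ψ, (K − μN) ψ⟩ = E₀(H_g) + (g/L²)·Re⟨ψ, Δ_d†Δ_d ψ⟩`. -/
theorem re_zeroField_rayleigh_of_crutch_groundState {tp U μ g : ℝ}
    {ψ : Fock (Orb (FermionTorus 2 L))} (hψ : star ψ ⬝ᵥ ψ = 1)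
    (hGS : ψ ∈ (crutchTorusTT' L tp U μ g).groundSpace) :
    (star ψ ⬝ᵥ dWaveSourceTorusTT' L tp U μ 0 *ᵥ ψ).re =
      (crutchTorusTT' L tp U μ g).groundEnergy + g / (L : ℝ) ^ 2 * (star ψ ⬝ᵥ pairSq L *ᵥ ψ).re := by
  have hHψ := (mem_groundSpace_iff _ ψ).1 hGS
  have hsplit : dWaveSourceTorusTT' L tp U μ 0 *ᵥ ψ =
      crutchTorusTT' L tp U μ g *ᵥ ψ + ((g / (L : ℝ) ^ 2 : ℝ) : ℂ) • (pairSq L *ᵥ ψ) := by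
    rw [crutchTorusTT', sub_mulVec, smul_mulVec, sub_add_cancel]
  rw [hsplit, dotProduct_add, dotProduct_smul, hHψ, dotProduct_smul, hψ, smul_eq_mul, mul_one,
    smul_eq_mul, Complex.add_re, Complex.ofReal_re, Complex.mul_re, Complex.ofReal_re,
    Complex.ofReal_im, zero_mul, sub_zero]

/-- **Reduction.** The operator square at the field `h₀` for every `g > 0` implies P1-GC; everything
else is the variational principle and the two cells (the chain
`lo·L² ≤ E₀(K−μN) ≤ E₀(H_g) + (g/L²)X ≤ hi·L² + h₀²L²/g + (g/L²)X`, `X = Re⟨ψ, Δ_d†Δ_d ψ⟩`). -/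
theorem crutchODLROFloorGC_of_le_sourced_add {tp U μ h0 : ℝ} {lo hi : ℚ}
    (hop : ∀ g : ℝ, 0 < g → CrutchLeSourcedAdd L tp U μ g h0) :
    CrutchODLROFloorGC L tp U μ h0 lo hi := by
  intro hlo hhi g hg ψ hψ hGS
  unfold SourcedTorusEnergyLowerRow at hlo
  unfold SourcedTorusEnergyUpperRow at hhi
  have hL : (0 : ℝ) < (L : ℝ) := by exact_mod_cast Nat.pos_of_ne_zero (NeZero.ne L)
  have hN : (0 : ℝ) < (L : ℝ) ^ 2 := by positivity
  have hA := groundEnergy_crutch_le (hop g hg)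
  have hB := Matrix.groundEnergy_le_rayleigh_holds (dWaveSourceTorusTT'_isHermitian L tp U μ 0) ψ hψ
  rw [re_zeroField_rayleigh_of_crutch_groundState hψ hGS] at hB
  -- the chain `lo·L² ≤ hi·L² + h₀²L²/g + (g/L²)·X`, divided by `g·L⁴`
  set X : ℝ := (star ψ ⬝ᵥ pairSq L *ᵥ ψ).re
  unfold pairLRO
  rw [div_le_div_iff₀ hg (by positivity : (0 : ℝ) < (L : ℝ) ^ 4)]
  have key : (((lo : ℚ) : ℝ) - ((hi : ℚ) : ℝ) - h0 ^ 2 / g) * (L : ℝ) ^ 2 ≤ g / (L : ℝ) ^ 2 * X := by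
    have e : (((lo : ℚ) : ℝ) - ((hi : ℚ) : ℝ) - h0 ^ 2 / g) * (L : ℝ) ^ 2 =
        ((lo : ℚ) : ℝ) * (L : ℝ) ^ 2 - ((hi : ℚ) : ℝ) * (L : ℝ) ^ 2 - h0 ^ 2 * (L : ℝ) ^ 2 / g := by
      ring
    rw [e]
    linarith
  calc (((lo : ℚ) : ℝ) - ((hi : ℚ) : ℝ) - h0 ^ 2 / g) * (L : ℝ) ^ 4
      = (((lo : ℚ) : ℝ) - ((hi : ℚ) : ℝ) - h0 ^ 2 / g) * (L : ℝ) ^ 2 * (L : ℝ) ^ 2 := by ring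
    _ ≤ g / (L : ℝ) ^ 2 * X * (L : ℝ) ^ 2 := mul_le_mul_of_nonneg_right key hN.le
    _ = X * g := by field_simp

/-- Uniform form: the per-torus reduction under the uniform cells. -/
theorem crutchODLROFloorGCUniform_of_le_sourced_add {tp U μ h0 : ℝ} {q L₀ : ℕ} {lo hi : ℚ}
    (hop : ∀ (L : ℕ) [NeZero L], L₀ ≤ L → q ∣ L → ∀ g : ℝ, 0 < g → CrutchLeSourcedAdd L tp U μ g h0) :
    CrutchODLROFloorGCUniform tp U μ h0 q L₀ lo hi :=
  fun hlo hhi L _ hL hq =>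
    crutchODLROFloorGC_of_le_sourced_add (hop L hL hq) (hlo L hL hq) (hhi L hL hq)

end Reduction

/-! ## §4  The operator square: `CrutchLeSourcedAdd` for `0 < g` -/

section Square

/-- `‖M x‖² = ⟨x, MᴴM x⟩` in `dotProduct` language. -/
theorem star_mulVec_dotProduct_mulVec_eq {n : Type*} [Fintype n] (M : Matrix n n ℂ) (x : n → ℂ) :
    star (M *ᵥ x) ⬝ᵥ (M *ᵥ x) = star x ⬝ᵥ (Mᴴ * M) *ᵥ x := by
  rw [star_mulVec, ← dotProduct_mulVec, mulVec_mulVec]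

/-- `Re⟨x, Mᴴ x⟩ = Re⟨x, M x⟩` (cf. the tree's `re_star_dotProduct_conjTranspose_mulVec`, not imported). -/
theorem re_dotProduct_conjTranspose_mulVec_eq {n : Type*} [Fintype n] (M : Matrix n n ℂ) (x : n → ℂ) :
    (star x ⬝ᵥ Mᴴ *ᵥ x).re = (star x ⬝ᵥ M *ᵥ x).re := by
  have : star x ⬝ᵥ Mᴴ *ᵥ x = star (star x ⬝ᵥ M *ᵥ x) := by
    rw [dotProduct_mulVec, ← star_mulVec, star_dotProduct]
  rw [this, Complex.star_def, Complex.conj_re]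

/-- The completed square in a vector (real `b`): `0 ≤ Re⟨x, MᴴM x⟩ − 2b·Re⟨x, M x⟩ + b²·Re⟨x, x⟩`
(`= ‖(M − b)x‖²`, `dotProduct_star_self_nonneg`). -/
theorem re_completeSquare_nonneg {n : Type*} [Fintype n] (M : Matrix n n ℂ) (x : n → ℂ) (b : ℝ) :
    0 ≤ (star x ⬝ᵥ (Mᴴ * M) *ᵥ x).re - 2 * b * (star x ⬝ᵥ M *ᵥ x).re +
      b ^ 2 * (star x ⬝ᵥ x).re := by
  have h0 := dotProduct_star_self_nonneg (M *ᵥ x - (b : ℂ) • x)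
  obtain ⟨hre, -⟩ := Complex.nonneg_iff.mp h0
  have hexp : star (M *ᵥ x - (b : ℂ) • x) ⬝ᵥ (M *ᵥ x - (b : ℂ) • x) =
      star (M *ᵥ x) ⬝ᵥ (M *ᵥ x) - (b : ℂ) * (star (M *ᵥ x) ⬝ᵥ x) -
        (b : ℂ) * (star x ⬝ᵥ M *ᵥ x) + (b : ℂ) * ((b : ℂ) * (star x ⬝ᵥ x)) := by
    simp only [star_sub, star_smul, Complex.star_def, Complex.conj_ofReal, sub_dotProduct,
      dotProduct_sub, smul_dotProduct, dotProduct_smul, smul_eq_mul]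
    ring
  rw [hexp, star_mulVec_dotProduct_mulVec_eq, star_dotProduct (M *ᵥ x) x] at hre
  simp only [Complex.sub_re, Complex.add_re, Complex.mul_re, Complex.ofReal_re, Complex.ofReal_im,
    zero_mul, sub_zero, Complex.star_def, Complex.conj_re] at hre
  nlinarith [hre]

/-- **Step (1) PROVED**: for `0 < g` and every real `h`,
`Re⟨x, H_g x⟩ ≤ Re⟨x, A(h) x⟩ + (h² L²/g)·‖x‖²` — the square of `Δ_d x − (hL²/g)·x`, weighted by `g/L²`. -/
theorem crutchLeSourcedAdd_of_pos (tp U μ h : ℝ) {g : ℝ} (hg : 0 < g) :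
    CrutchLeSourcedAdd L tp U μ g h := by
  intro x
  have hL : (0 : ℝ) < (L : ℝ) := by exact_mod_cast Nat.pos_of_ne_zero (NeZero.ne L)
  have hN : (0 : ℝ) < (L : ℝ) ^ 2 := by positivity
  have hsq := re_completeSquare_nonneg (pairField dWaveFormFactor L) x (h * (L : ℝ) ^ 2 / g)
  have hH : (star x ⬝ᵥ crutchTorusTT' L tp U μ g *ᵥ x).re =
      (star x ⬝ᵥ dWaveSourceTorusTT' L tp U μ 0 *ᵥ x).re -
        g / (L : ℝ) ^ 2 * (star x ⬝ᵥ pairSq L *ᵥ x).re := by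
    rw [crutchTorusTT', sub_mulVec, smul_mulVec, dotProduct_sub, dotProduct_smul, smul_eq_mul,
      Complex.sub_re, Complex.mul_re, Complex.ofReal_re, Complex.ofReal_im, zero_mul, sub_zero]
  -- `A(h) = A(0) − h (Δ_d + Δ_d†)` (the tree's `dWaveSourceTorusTT'_eq_zero_source_sub`, not imported)
  have hsub : dWaveSourceTorusTT' L tp U μ h = dWaveSourceTorusTT' L tp U μ 0 -
      (h : ℂ) • (pairField dWaveFormFactor L + (pairField dWaveFormFactor L)ᴴ) := by
    unfold dWaveSourceTorusTT'
    simp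
  have hA : (star x ⬝ᵥ dWaveSourceTorusTT' L tp U μ h *ᵥ x).re =
      (star x ⬝ᵥ dWaveSourceTorusTT' L tp U μ 0 *ᵥ x).re -
        2 * h * (star x ⬝ᵥ pairField dWaveFormFactor L *ᵥ x).re := by
    rw [hsub, sub_mulVec, smul_mulVec, add_mulVec, dotProduct_sub,
      dotProduct_smul, dotProduct_add, smul_eq_mul, Complex.sub_re, Complex.mul_re, Complex.add_re,
      Complex.add_im, Complex.ofReal_re, Complex.ofReal_im, zero_mul, sub_zero,
      re_dotProduct_conjTranspose_mulVec_eq]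
    ring
  rw [hH, hA]
  unfold pairSq
  set P : ℝ := (star x ⬝ᵥ ((pairField dWaveFormFactor L)ᴴ * pairField dWaveFormFactor L) *ᵥ x).re
  set R : ℝ := (star x ⬝ᵥ pairField dWaveFormFactor L *ᵥ x).re
  set nrm : ℝ := (star x ⬝ᵥ x).re
  set A0 : ℝ := (star x ⬝ᵥ dWaveSourceTorusTT' L tp U μ 0 *ᵥ x).re
  have key : 0 ≤ g / (L : ℝ) ^ 2 * P - 2 * h * R + h ^ 2 * (L : ℝ) ^ 2 / g * nrm := by
    have expand : g / (L : ℝ) ^ 2 *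
        (P - 2 * (h * (L : ℝ) ^ 2 / g) * R + (h * (L : ℝ) ^ 2 / g) ^ 2 * nrm) =
        g / (L : ℝ) ^ 2 * P - 2 * h * R + h ^ 2 * (L : ℝ) ^ 2 / g * nrm := by
      field_simp
    exact expand ▸ mul_nonneg (div_pos hg hN).le hsq
  linarith

end Square

/-! ## §5  P1-GC PROVED, uniform form, and the by-name reader on two uniform cells -/

section Floor

/-- **P1-GC PROVED**: the crutch ODLRO floor on one torus from the two energy cells — for every `g > 0`
and every unit ground-state vector `ψ` of `H_{g,L} = K_L − μN − (g/L²)Δ_d†Δ_d`,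
`(lo − hi − h₀²/g)/g ≤ Re⟨ψ, Δ_d†Δ_d ψ⟩/L⁴`. Class: GC Fock space at one `μ`, one finite torus. -/
theorem crutchODLROFloorGC_holds (tp U μ h0 : ℝ) (lo hi : ℚ) : CrutchODLROFloorGC L tp U μ h0 lo hi :=
  crutchODLROFloorGC_of_le_sourced_add fun _ hg => crutchLeSourcedAdd_of_pos tp U μ h0 hg

/-- **P1-GC, uniform in `L`, PROVED** (both cells on the same `(q, L₀)`). -/
theorem crutchODLROFloorGCUniform_holds (tp U μ h0 : ℝ) (q L₀ : ℕ) (lo hi : ℚ) :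
    CrutchODLROFloorGCUniform tp U μ h0 q L₀ lo hi :=
  crutchODLROFloorGCUniform_of_le_sourced_add fun _ _ _ _ _ hg => crutchLeSourcedAdd_of_pos tp U μ h0 hg

/-- **By-name reader** (corollary column): a zero-field floor cell on `(q₁, L₁)` and a sourced cap cell at
`h₀` on `(q₂, L₂)`, each with its own side progression, give the crutch floor on every torus both cells
reach (`L ≥ L₁, L₂`, `q₁ ∣ L`, `q₂ ∣ L`). One application per pair of certificate nodes of the shapes
`SourcedEnergyLowerRow tp U μ 0 q₁ L₁ lo` / `SourcedEnergyUpperRow tp U μ h₀ q₂ L₂ hi`. -/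
theorem crutchODLROFloor_of_rows {tp U μ h0 : ℝ} {q₁ q₂ L₁ L₂ : ℕ} {lo hi : ℚ}
    (hlo : SourcedEnergyLowerRow tp U μ 0 q₁ L₁ lo) (hhi : SourcedEnergyUpperRow tp U μ h0 q₂ L₂ hi)
    (L : ℕ) [NeZero L] (hL₁ : L₁ ≤ L) (hL₂ : L₂ ≤ L) (hq₁ : q₁ ∣ L) (hq₂ : q₂ ∣ L)
    {g : ℝ} (hg : 0 < g) (ψ : Fock (Orb (FermionTorus 2 L))) (hψ : star ψ ⬝ᵥ ψ = 1)
    (hGS : ψ ∈ (crutchTorusTT' L tp U μ g).groundSpace) :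
    (((lo : ℚ) : ℝ) - ((hi : ℚ) : ℝ) - h0 ^ 2 / g) / g ≤ pairLRO L ψ :=
  crutchODLROFloorGC_holds (L := L) tp U μ h0 lo hi (hlo L hL₁ hq₁) (hhi L hL₂ hq₂) g hg ψ hψ hGS

/-- The reader with the threshold on its face: if the chord is positive, `lo > hi`, then for every
`g > g₀ = h₀²/(lo − hi)` the crutch ground states on the tori both cells reach have STRICTLY POSITIVE pair
ODLRO density (bounded below by the positive rational-slot expression of `crutchODLROFloor_of_rows`). -/
theorem pairLRO_pos_of_rows {tp U μ h0 : ℝ} {q₁ q₂ L₁ L₂ : ℕ} {lo hi : ℚ}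
    (hlo : SourcedEnergyLowerRow tp U μ 0 q₁ L₁ lo) (hhi : SourcedEnergyUpperRow tp U μ h0 q₂ L₂ hi)
    (hchord : hi < lo) (L : ℕ) [NeZero L] (hL₁ : L₁ ≤ L) (hL₂ : L₂ ≤ L) (hq₁ : q₁ ∣ L) (hq₂ : q₂ ∣ L)
    {g : ℝ} (hg : h0 ^ 2 / (((lo : ℚ) : ℝ) - ((hi : ℚ) : ℝ)) < g)
    (ψ : Fock (Orb (FermionTorus 2 L))) (hψ : star ψ ⬝ᵥ ψ = 1)
    (hGS : ψ ∈ (crutchTorusTT' L tp U μ g).groundSpace) :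
    0 < pairLRO L ψ := by
  have hG : (0 : ℝ) < ((lo : ℚ) : ℝ) - ((hi : ℚ) : ℝ) := by
    have : ((hi : ℚ) : ℝ) < ((lo : ℚ) : ℝ) := by exact_mod_cast hchord
    linarith
  have hgpos : 0 < g := lt_of_le_of_lt (by positivity) hg
  have hfloor := crutchODLROFloor_of_rows hlo hhi L hL₁ hL₂ hq₁ hq₂ hgpos ψ hψ hGS
  have hpos : 0 < (((lo : ℚ) : ℝ) - ((hi : ℚ) : ℝ) - h0 ^ 2 / g) / g :=
    (crutchFloor_pos_iff hG hgpos).2 hg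
  exact hpos.trans_le hfloor

end Floor

end Summit.Ventures.CertifiedManyBodySolver.Observables
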